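import Summits.QuantumFields.YangMills.Theses.PencilRigidity

/-!
# Line `block-filtration-covariance-ladder` — skeleton for crux `PencilRigidity.CurvatureKernelBound`
(stmt-QuantumFields-11687), crux-plan round 1.

Doob's ladder for the plaquette covariance along a (Bałaban-type) block filtration of each torus
of the Wilson scheme: the renormalised lattice two-point kernel `c_k² Cov_k(Q₀, Q_z)` of the action
density is bounded, uniformly in `k`, by `C (a_k‖z‖)^(η-10)` on a physical ball `a_k‖z‖ ≤ θ`
(`LocalLatticeKernelBound`), which the transfer lemma turns into the crux's continuous real kernel
below the `|x|⁻¹⁰` threshold; degenerate `W₁`-inhabitants (truncated two-point function `≡ 0` on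
off-diagonal real tensors: zero scheme, `β ≡ 0`, ultralocal limits, triage example G2) are a
separate branch with the constant kernel `κ²`.

Stubs (sorried, registered): `stub_degenerate`, `stub_transfer`, `stub_ladder` (the engine,
`c_k`-free), `stub_calibration`, `stub_summation`.
Composition (A12 shape, no hypotheses, concludes the crux by name; its only gaps are the stubs it
calls): `CurvatureKernelBound_of`.
-/

set_option autoImplicit false

noncomputable section

namespace Summit.QuantumFields.YangMills.Cruxes.CurvatureKernelBound.BlockFiltrationCovarianceLadder

open scoped BigOperators Topology ENNReal
open Filter MeasureTheory
open Literature.MathematicalPhysics.QuantumLattice Literature.MathematicalPhysics.AQFT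
  Literature.MathematicalPhysics.QuantumFieldTheory

/-- Euclidean `ℝ⁴`. -/
local notation "E4" => EuclideanSpace ℝ (Fin 4)

/-- Lattice sites `ℤ⁴`. -/
local notation "Site4" => Literature.Probability.LatticeModels.Site 4

section Defs

/-- **The conclusion of the crux for one family `S₁`, verbatim**: a real kernel, continuous off the
origin, below the `|x|⁻¹⁰` threshold, representing `S₁ 2` on `⁰𝒮`. -/
def KernelConclusion (S₁ : SchwingerFamily E4) : Prop :=
  ∃ (K : E4 → ℝ) (C η : ℝ), 0 < η ∧ ContinuousOn K {x : E4 | x ≠ 0} ∧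
    (∀ x : E4, x ≠ 0 → |K x| ≤ C * (1 + ‖x‖ ^ (η - 10))) ∧
    ∀ F : SchwartzMap (Fin 2 → E4) ℂ, IsOffDiagonal F →
      MeasureTheory.Integrable (fun x : Fin 2 → E4 => (K (x 0 - x 1) : ℂ) * F x) ∧
        S₁ 2 F = ∫ x : Fin 2 → E4, (K (x 0 - x 1) : ℂ) * F x

/-- **Degenerate branch (B)**: the truncated two-point function of `S₁` vanishes on real
off-diagonal tensors, `S₁ 2 (f ⊗ g) = S₁ 1 f · S₁ 1 g`. Inhabited by the zero scheme, by every
scheme with `β_k = 0` infinitely often (Disproof.lean §4), by ultralocal / bounded-`β` limits and by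
the triage example G2 (`β_k ≡ β₀` small, `c_k = a_k⁻⁵`). -/
def TruncatedTwoPointVanishes (S₁ : SchwingerFamily E4) : Prop :=
  ∀ (f g : SchwartzMap E4 ℝ) (F : SchwartzMap (Fin 2 → E4) ℂ) (F₁ G₁ : SchwartzMap (Fin 1 → E4) ℂ),
    IsTensorOf F ![ofRealTest f, ofRealTest g] → IsOffDiagonal F →
    IsTensorOf F₁ ![ofRealTest f] → IsTensorOf G₁ ![ofRealTest g] →
      S₁ 2 F = S₁ 1 F₁ * S₁ 1 G₁

/-- Variance of the conditional mean `E[f | m]` (a rung height of the ladder). -/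
def cvar {Ω : Type} [MeasurableSpace Ω] (μ : Measure Ω) (m : MeasurableSpace Ω) (f : Ω → ℝ) : ℝ :=
  ∫ ω, (condExp m μ f ω - ∫ ω', f ω' ∂μ) ^ 2 ∂μ

/-- Martingale increment `E[f | m] - E[f | m']` between two levels of the filtration. -/
def incr {Ω : Type} [MeasurableSpace Ω] (μ : Measure Ω) (m m' : MeasurableSpace Ω) (f : Ω → ℝ) :
    Ω → ℝ :=
  fun ω => condExp m μ f ω - condExp m' μ f ω

variable {G : Type} [Group G] [TopologicalSpace G] [IsTopologicalGroup G] [CompactSpace G]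
  [MeasurableSpace G] [BorelSpace G]

/-- **The hypothesis package `W₁ r sch S₁` of the crux, verbatim** (the `let W₁ := …` of
`PencilRigidity.CurvatureKernelBound`): lattice convergence of the renormalised action-density
strings to `S₁` on `⁰𝒮`; E0 (normalisation, hermiticity), E0', E2, E3, E4 of `S₁.toLabelled`;
translations and proper signed permutations on `⁰𝒮`; continuum gap and uniform lattice gap. -/
def W1 (r : LatticeRep G) (sch : SpeciesScheme (YMSpecies G)) (S₁ : SchwingerFamily E4) : Prop :=
  (∀ (n : ℕ), n ≠ 0 → ∀ (f : Fin n → SchwartzMap E4 ℝ) (F : SchwartzMap (Fin n → E4) ℂ),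
      IsTensorOf F (fun i => ofRealTest (f i)) → IsOffDiagonal F →
        Filter.Tendsto (fun k : ℕ =>
          ((latticeSchwinger r.ρ sch (fun s => s.F) k n (fun _ => r.curvature) f : ℝ) : ℂ))
          Filter.atTop (nhds (S₁ n F))) ∧
  (S₁.toLabelled.IsNormalized ∧ S₁.toLabelled.IsHermitian ∧ S₁.toLabelled.HasLinearGrowth ∧
      S₁.toLabelled.IsReflectionPositive ∧ S₁.toLabelled.IsSymmetric ∧
      S₁.toLabelled.HasClusterProperty) ∧
  (∀ (n : ℕ) (a : E4) (F : SchwartzMap (Fin n → E4) ℂ), IsOffDiagonal F →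
      S₁ n (translateMulti a F) = S₁ n F) ∧
  (∀ (R : E4 ≃ₗᵢ[ℝ] E4), LinearMap.det (R.toLinearEquiv : E4 →ₗ[ℝ] E4) = 1 →
      (∀ i : Fin 4, ∃ j : Fin 4, R (EuclideanSpace.single i 1) = EuclideanSpace.single j 1 ∨
        R (EuclideanSpace.single i 1) = -EuclideanSpace.single j 1) →
      ∀ (n : ℕ) (F : SchwartzMap (Fin n → E4) ℂ), IsOffDiagonal F →
        S₁ n (linActMulti R F) = S₁ n F) ∧
  (∃ Δ : ℝ, 0 < Δ ∧ S₁.toLabelled.HasMassGap Δ ∧ HasLatticeMassGap r sch Δ)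

/-- The action density `Q_z = ∑_{μ<ν} Re tr ρ(U_{p_{μν}(z)})` at the lattice site `z`, read on the
periodic lift of a torus configuration of side `S` (the integrand of `latticeSchwinger` /
`smearedLatticeField` for the curvature species, before smearing and renormalisation). -/
def torusDensity (r : LatticeRep G) (S : ℕ) (z : Site4) (U : GaugeConfig 4 S G) : ℝ :=
  actionDensity r.ρ (configShift (-z) (torusLift S U))

/-- **Lattice truncated two-point function of the action density** at step `k` of the scheme:
`Cov_k(Q₀, Q_z)` under Wilson's measure at `β_k` on the torus of side `2L_k+1` (the general-`z`
twin of `latticeConnectedCorr`; bare, i.e. without `c_k`). -/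
def latCov (r : LatticeRep G) (sch : SpeciesScheme (YMSpecies G)) (k : ℕ) (z : Site4) : ℝ :=
  (∫ U, torusDensity r (sch.side k) 0 U * torusDensity r (sch.side k) z U
      ∂(wilsonMeasure (d := 4) (L := sch.side k) r.ρ (sch.β k))) -
    (∫ U, torusDensity r (sch.side k) 0 U ∂(wilsonMeasure (d := 4) (L := sch.side k) r.ρ (sch.β k))) *
      ∫ U, torusDensity r (sch.side k) z U ∂(wilsonMeasure (d := 4) (L := sch.side k) r.ρ (sch.β k))

/-- **Local uniform lattice kernel bound** (the transfer's input, the triage's C⁺ restricted to a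
physical ball and stated for ONE scheme): for some `C`, `η > 0`, `θ > 0` and all large `k`, every
non-zero lattice separation `z` in the box with `a_k ‖z‖ ≤ θ` has
`c_k² |Cov_k(Q₀, Q_z)| ≤ C (a_k ‖z‖)^(η-10)`. Boundedness at physical distances `≥ θ` and
continuity off `0` are NOT asked: they come from reflection positivity inside `stub_transfer`. -/
def LocalLatticeKernelBound (r : LatticeRep G) (sch : SpeciesScheme (YMSpecies G)) : Prop :=
  ∃ (C η θ : ℝ), 0 < η ∧ 0 < θ ∧ ∀ᶠ k in Filter.atTop, ∀ z : Site4,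
    z ∈ Literature.Probability.LatticeModels.box 4 (sch.L k) → z ≠ 0 →
    sch.a k * ‖siteToE z‖ ≤ θ →
      (sch.c r.curvature k) ^ 2 * |latCov r sch k z| ≤ C * (sch.a k * ‖siteToE z‖) ^ (η - 10)

/-- **Ladder data, calibrated** (renormalised levels; produced from `LadderDataPure` by
`stub_calibration`, consumed by `stub_summation`): block
factor `M ≥ 2`, constants `A, κ, B, η, θ > 0`, and for all large `k` a decreasing filtration
`ℱ₀ = 𝔐 ⊇ ℱ₁ ⊇ ⋯` of sub-σ-algebras of the torus configuration space at step `k`, with top scale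
`M^J ≥ θ / a_k`, such that
* (CE) RENORMALISED CONDITIONAL-MEAN VARIANCES: `c_k² Var(E[Q_z | ℱ_i]) ≤ B (a_k M^i)^(η-10)` for
  `i ≤ J` and every site `z` — canonical `(a_k M^i)^(-8)` at every scale with two powers to spare,
  calibrated at the top (physical) scale by `W₁`'s own convergence;
* (CD) ONE-STEP CONDITIONAL DECORRELATION AT THE BLOCK SCALE: the `i`-th martingale increments of
  `Q₀` and `Q_z` satisfy `|E[D_i(Q₀) D_i(Q_z)]| ≤ A e^{-κ‖z‖/M^(i+1)} ‖D_i(Q₀)‖₂ ‖D_i(Q_z)‖₂` for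
  `i < J` and `z` in the window (the block-scale mass of the one-step fluctuation measure). -/
def LadderData (r : LatticeRep G) (sch : SpeciesScheme (YMSpecies G)) : Prop :=
  ∃ (M : ℕ) (A κ B η θ : ℝ), 2 ≤ M ∧ 0 < κ ∧ 0 < B ∧ 0 < η ∧ 0 < θ ∧
    ∀ᶠ k in Filter.atTop,
      ∃ (J : ℕ) (ℱ : ℕ → MeasurableSpace (GaugeConfig 4 (sch.side k) G)),
        Antitone ℱ ∧ (∀ i, ℱ i ≤ (inferInstance : MeasurableSpace (GaugeConfig 4 (sch.side k) G))) ∧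
        ℱ 0 = (inferInstance : MeasurableSpace (GaugeConfig 4 (sch.side k) G)) ∧
        θ / sch.a k ≤ (M : ℝ) ^ J ∧
        (∀ i : ℕ, i ≤ J → ∀ z : Site4,
          (sch.c r.curvature k) ^ 2 *
              cvar (wilsonMeasure (d := 4) (L := sch.side k) r.ρ (sch.β k)) (ℱ i)
                (torusDensity r (sch.side k) z) ≤
            B * (sch.a k * (M : ℝ) ^ i) ^ (η - 10)) ∧
        (∀ i : ℕ, i < J → ∀ z : Site4, z ∈ Literature.Probability.LatticeModels.box 4 (sch.L k) →
          sch.a k * ‖siteToE z‖ ≤ θ →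
          |∫ U, incr (wilsonMeasure (d := 4) (L := sch.side k) r.ρ (sch.β k)) (ℱ i) (ℱ (i + 1))
                  (torusDensity r (sch.side k) 0) U *
                incr (wilsonMeasure (d := 4) (L := sch.side k) r.ρ (sch.β k)) (ℱ i) (ℱ (i + 1))
                  (torusDensity r (sch.side k) z) U
              ∂(wilsonMeasure (d := 4) (L := sch.side k) r.ρ (sch.β k))| ≤
            A * Real.exp (-(κ * ‖siteToE z‖ / (M : ℝ) ^ (i + 1))) *
              Real.sqrt (∫ U, (incr (wilsonMeasure (d := 4) (L := sch.side k) r.ρ (sch.β k)) (ℱ i)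
                (ℱ (i + 1)) (torusDensity r (sch.side k) 0) U) ^ 2
                  ∂(wilsonMeasure (d := 4) (L := sch.side k) r.ρ (sch.β k))) *
              Real.sqrt (∫ U, (incr (wilsonMeasure (d := 4) (L := sch.side k) r.ρ (sch.β k)) (ℱ i)
                (ℱ (i + 1)) (torusDensity r (sch.side k) z) U) ^ 2
                  ∂(wilsonMeasure (d := 4) (L := sch.side k) r.ρ (sch.β k))))

/-- **Bare smeared truncated two-point function** at step `k`: the covariance, under Wilson's
measure on the torus of side `2L_k+1`, of the two smeared bare action-density fields
`a_k⁴ ∑_{x ∈ box} h(a_k x) Q_x` (`smearedLatticeField` with `c = 1`, `m = 0`) for `h = f, g`. By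
bilinearity `c_k² · smearedCov = 𝔖_k,2(f ⊗ g) - 𝔖_k,1(f) 𝔖_k,1(g)` in terms of `latticeSchwinger`,
so `W₁` (`n = 2`, `n = 1`) makes `c_k² · smearedCov_k(f, g)` converge — the line's only calibration. -/
def smearedCov (r : LatticeRep G) (sch : SpeciesScheme (YMSpecies G)) (k : ℕ)
    (f g : SchwartzMap E4 ℝ) : ℝ :=
  (∫ U, smearedLatticeField (actionDensity r.ρ) (Literature.Probability.LatticeModels.box 4 (sch.L k))
        (sch.a k) 1 0 f (torusLift (sch.side k) U) *
      smearedLatticeField (actionDensity r.ρ) (Literature.Probability.LatticeModels.box 4 (sch.L k))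
        (sch.a k) 1 0 g (torusLift (sch.side k) U)
      ∂(wilsonMeasure (d := 4) (L := sch.side k) r.ρ (sch.β k))) -
    (∫ U, smearedLatticeField (actionDensity r.ρ) (Literature.Probability.LatticeModels.box 4 (sch.L k))
        (sch.a k) 1 0 f (torusLift (sch.side k) U)
        ∂(wilsonMeasure (d := 4) (L := sch.side k) r.ρ (sch.β k))) *
      ∫ U, smearedLatticeField (actionDensity r.ρ) (Literature.Probability.LatticeModels.box 4 (sch.L k))
        (sch.a k) 1 0 g (torusLift (sch.side k) U)
        ∂(wilsonMeasure (d := 4) (L := sch.side k) r.ρ (sch.β k))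

/-- **Pure ladder data** — the ENGINE's output, free of the species renormalisation `c_k`
(everything RELATIVE to the top scale; every accumulated logarithm cancels in ratios): block factor
`M ≥ 2`, constants, two real test functions `f, g` with supports at distance `≥ θ` (the
calibrating pair), and for all large `k` a decreasing filtration `ℱ₀ = 𝔐 ⊇ ℱ₁ ⊇ ⋯ ⊇ ℱ_J` of the
torus configuration space with top scale `θ/a_k ≤ M^J ≤ M θ/a_k`, such that
* (RATIO) VARIANCE-RATIO LADDER: `Var(E[Q_z|ℱ_i]) ≤ C_r (M^J/M^i)^(10-η) Var(E[Q_z|ℱ_J])`, `i ≤ J`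
  — going down from the physical scale the conditional-mean variance of one plaquette grows at
  most like (scale ratio)^(10-η), canonical exponent `8`, the spare `2 - η` absorbing the relative
  response factors `exp(O(∑_{i≤l<J} g_l²)) ≤ (M^(J-i))^{O(g(θ)²)}`;
* (EDGE) ONE-SCALE COMPARABILITY at the top: `Var(E[Q_z|ℱ_J]) ≤ C_e |smearedCov_k(f, g)|`
  (both are scale-`θ` quantities of the same composite field; leading order at coupling `g(θ)`);
* (CD) ONE-STEP CONDITIONAL DECORRELATION at the block scale, as in `LadderData`. -/
def LadderDataPure (r : LatticeRep G) (sch : SpeciesScheme (YMSpecies G)) : Prop :=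
  ∃ (M : ℕ) (A κ Cr Ce η θ : ℝ) (f g : SchwartzMap E4 ℝ), 2 ≤ M ∧ 0 < κ ∧ 0 < Cr ∧ 0 < Ce ∧
    0 < η ∧ 0 < θ ∧ (∀ x ∈ tsupport f, ∀ y ∈ tsupport g, θ ≤ dist x y) ∧
    ∀ᶠ k in Filter.atTop,
      ∃ (J : ℕ) (ℱ : ℕ → MeasurableSpace (GaugeConfig 4 (sch.side k) G)),
        Antitone ℱ ∧ (∀ i, ℱ i ≤ (inferInstance : MeasurableSpace (GaugeConfig 4 (sch.side k) G))) ∧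
        ℱ 0 = (inferInstance : MeasurableSpace (GaugeConfig 4 (sch.side k) G)) ∧
        θ / sch.a k ≤ (M : ℝ) ^ J ∧ (M : ℝ) ^ J ≤ M * θ / sch.a k ∧
        (∀ i : ℕ, i ≤ J → ∀ z : Site4,
          cvar (wilsonMeasure (d := 4) (L := sch.side k) r.ρ (sch.β k)) (ℱ i)
              (torusDensity r (sch.side k) z) ≤
            Cr * ((M : ℝ) ^ J / (M : ℝ) ^ i) ^ (10 - η) *
              cvar (wilsonMeasure (d := 4) (L := sch.side k) r.ρ (sch.β k)) (ℱ J)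
                (torusDensity r (sch.side k) z)) ∧
        (∀ z : Site4,
          cvar (wilsonMeasure (d := 4) (L := sch.side k) r.ρ (sch.β k)) (ℱ J)
              (torusDensity r (sch.side k) z) ≤
            Ce * |smearedCov r sch k f g|) ∧
        (∀ i : ℕ, i < J → ∀ z : Site4, z ∈ Literature.Probability.LatticeModels.box 4 (sch.L k) →
          sch.a k * ‖siteToE z‖ ≤ θ →
          |∫ U, incr (wilsonMeasure (d := 4) (L := sch.side k) r.ρ (sch.β k)) (ℱ i) (ℱ (i + 1))
                  (torusDensity r (sch.side k) 0) U *
                incr (wilsonMeasure (d := 4) (L := sch.side k) r.ρ (sch.β k)) (ℱ i) (ℱ (i + 1))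
                  (torusDensity r (sch.side k) z) U
              ∂(wilsonMeasure (d := 4) (L := sch.side k) r.ρ (sch.β k))| ≤
            A * Real.exp (-(κ * ‖siteToE z‖ / (M : ℝ) ^ (i + 1))) *
              Real.sqrt (∫ U, (incr (wilsonMeasure (d := 4) (L := sch.side k) r.ρ (sch.β k)) (ℱ i)
                (ℱ (i + 1)) (torusDensity r (sch.side k) 0) U) ^ 2
                  ∂(wilsonMeasure (d := 4) (L := sch.side k) r.ρ (sch.β k))) *
              Real.sqrt (∫ U, (incr (wilsonMeasure (d := 4) (L := sch.side k) r.ρ (sch.β k)) (ℱ i)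
                (ℱ (i + 1)) (torusDensity r (sch.side k) z) U) ^ 2
                  ∂(wilsonMeasure (d := 4) (L := sch.side k) r.ρ (sch.β k))))

end Defs

/-! ## The registered stubs -/

/-- **stub_degenerate** (branch B; provable now, size L): if the truncated two-point function of
`S₁` vanishes on real off-diagonal tensors then the crux's conclusion holds with the CONSTANT kernel
`K ≡ κ²`, `κ = lim_k c_k (⟨Q⟩_k - m_k)` read off the `n = 1` lattice convergence (Riemann sums of
one real test function with `∫ f = 1`), `C = κ²`, `η = 10`: `S₁ 1 f = κ ∫ f`, so
`S₁ 2 (f ⊗ g) = κ² ∫ f ∫ g` on real off-diagonal tensors, and the complex span of compactly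
supported real off-diagonal tensors is dense in `⁰𝒮₂` (cut-off at the diagonal, Schwartz
seminorms), both sides being continuous. Cf. Disproof.lean `kernelConclusion_of_const` (proved)
and its §5 pinning lemmas. -/
theorem stub_degenerate :
    ∀ (G : Type) [Group G] [TopologicalSpace G] [IsTopologicalGroup G] [CompactSpace G]
      [MeasurableSpace G] [BorelSpace G], IsCompactSimpleLieGroup G →
      ∀ (r : LatticeRep G) (sch : SpeciesScheme (YMSpecies G)) (S₁ : SchwingerFamily E4),
        W1 r sch S₁ → TruncatedTwoPointVanishes S₁ → KernelConclusion S₁ := by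
  sorry

/-- **stub_transfer** (the Transfer `C⁺ ∧ W₁ ⇒ crux`; provable now, size XL): from `W₁` and the
local uniform lattice kernel bound, the crux's conclusion. (1) The renormalised lattice kernels
`x ↦ c_k² Cov_k(Q₀, Q_{⌊x/a_k⌉}) + (c_k(⟨Q⟩_k - m_k))²` are uniformly bounded on compact subsets of
the punctured ball `{0 < |x| < θ}`; a weak-* limit `K₀ ∈ L^∞_loc` along a subsequence represents
`S₁ 2` on compactly supported real off-diagonal tensors there (Riemann sums, `W₁` at `n = 2` and
`n = 1`), hence on all of `⁰𝒮₂` supported at small separation (density + continuity). (2) By E2 +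
translations + E0 (`W₁`), the two-point distribution on `{x₀ ≠ 0}` is `∫ e^{-|x₀|E + i p·x⃗} dρ`
for a positive tempered measure `ρ` (tree: `exists_isJointSpectralMeasure_holds`); local
essential boundedness of `K₀` near `(t, 0⃗)` for small `t` forces `∫ e^{-tE} dρ < ∞` for all
`t > 0`, so the kernel is a continuous function on `{x₀ ≠ 0}`, bounded on `{|x₀| ≥ θ/2}` by
`∫ e^{-θE/2} dρ`; the proper signed permutations of `W₁` (transitive on signed axes) carry this to
the charts `{x_μ ≠ 0}`, which cover `ℝ⁴∖0`, and the chart kernels agree on overlaps (a.e., hence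
everywhere by continuity): one continuous real `K` on `ℝ⁴∖0`, `= K₀` a.e. near `0`, representing
`S₁ 2` on `⁰𝒮₂` (partition of unity + density), with `|K x| ≤ C (1 + ‖x‖^(η-10))` (near `0` from
the lattice bound by continuity, far from `0` by axis domination `|K x| ≤ K(‖x‖_∞ e₀)`). -/
theorem stub_transfer :
    ∀ (G : Type) [Group G] [TopologicalSpace G] [IsTopologicalGroup G] [CompactSpace G]
      [MeasurableSpace G] [BorelSpace G], IsCompactSimpleLieGroup G →
      ∀ (r : LatticeRep G) (sch : SpeciesScheme (YMSpecies G)) (S₁ : SchwingerFamily E4),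
        W1 r sch S₁ → LocalLatticeKernelBound r sch → KernelConclusion S₁ := by
  sorry

/-- **stub_ladder** (THE ENGINE, hardest; open-problem class = Bałaban's renormalisation group
with ONE composite observable, asked only for `c_k`-free RELATIVE bounds with two powers of slack):
for `W₁`-data in the NON-degenerate branch (there `a_k` is comparable to the inverse lattice
correlation length — degenerate data such as triage's G2 violate (RATIO) — so the window
`‖z‖ ≤ θ/a_k` sits inside the weak-coupling region once `θ` is small against the datum's physical
scale), Bałaban's gauge-covariant block-AVERAGING σ-algebras on the torus of side `2L_k+1` give a
filtration with (RATIO), (EDGE), (CD). (RATIO): small-field analyticity of the `i`-fold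
conditional density in the background block field — one plaquette responds to a background of
curvature `B` by `a⁴ w_i |B|² +` dimension `≥ 6` (`tr F²` is the lowest operator of its channel,
Lüscher–Weisz), and only the RELATIVE response `w_i/w_J = exp(O(∑_{i≤l<J} g_l²))` enters; (EDGE):
leading-order evaluation of two scale-`θ` quantities at coupling `g(θ)`; (CD): the block-scale mass
of the one-step fluctuation measures created by the averaging constraint, integrated over the
conditioning, large fields entering with their probability. Honours the near-miss
`¬ CurvatureKernelBoundWithoutLattice` of Disproof.lean: it is a statement about Wilson's lattice
measures along the scheme, and `stub_calibration` uses the lattice clause of `W₁`. -/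
theorem stub_ladder :
    ∀ (G : Type) [Group G] [TopologicalSpace G] [IsTopologicalGroup G] [CompactSpace G]
      [MeasurableSpace G] [BorelSpace G], IsCompactSimpleLieGroup G →
      ∀ (r : LatticeRep G) (sch : SpeciesScheme (YMSpecies G)) (S₁ : SchwingerFamily E4),
        W1 r sch S₁ → ¬ TruncatedTwoPointVanishes S₁ → LadderDataPure r sch := by
  sorry

/-- **stub_calibration** (provable now, size M): `W₁` pins the top of the ladder. With the
calibrating pair `f, g` of `LadderDataPure` (supports `θ` apart, so `f ⊗ g ∈ ⁰𝒮` via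
`SchwartzMap.tensorFin` / `isTensorOf_tensorFin`), bilinearity of the covariance gives
`c_k² smearedCov_k(f,g) = 𝔖_{k,2}(f ⊗ g) - 𝔖_{k,1}(f) 𝔖_{k,1}(g)`, which converges by `W₁` at
`n = 2` and `n = 1`, hence is bounded, `≤ T̄`, for large `k`; then (EDGE) gives
`c_k² Var(E[Q_z|ℱ_J]) ≤ C_e T̄` and (RATIO) with `M^J ≤ Mθ/a_k` gives
`c_k² Var(E[Q_z|ℱ_i]) ≤ C_r C_e T̄ (Mθ)^(10-η) (a_k M^i)^(η-10)`: the calibrated (CE) of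
`LadderData`; (CD) is carried over on the same filtration. -/
theorem stub_calibration :
    ∀ (G : Type) [Group G] [TopologicalSpace G] [IsTopologicalGroup G] [CompactSpace G]
      [MeasurableSpace G] [BorelSpace G], IsCompactSimpleLieGroup G →
      ∀ (r : LatticeRep G) (sch : SpeciesScheme (YMSpecies G)) (S₁ : SchwingerFamily E4),
        W1 r sch S₁ → LadderDataPure r sch → LadderData r sch := by
  sorry

/-- **stub_summation** (Doob's ladder summed; provable now, size M–L, pure probability on each
torus): `Cov(X, Y) = ∑_{i<J} E[D_i(X) D_i(Y)] + Cov(E[X|ℱ_J], E[Y|ℱ_J])` for `X, Y ∈ L²` and a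
decreasing filtration with `ℱ₀ = 𝔐` (tower property `condExp_condExp_of_le` kills the cross
terms); `‖D_i(X)‖₂² ≤ Var(E[X|ℱ_i])` (projection onto a space containing the constants) and
Cauchy–Schwarz on the top term; then (CD) × (CE) and the two geometric sums
`∑_{M^(i+1) ≥ ‖z‖} M^{i(η-10)} ≤ C ‖z‖^(η-10)`, `∑_{M^(i+1) < ‖z‖} e^{-κ‖z‖/M^(i+1)} M^{i(η-10)} ≤
C ‖z‖^(η-10)`, and `(M^J)^(η-10) ≤ ‖z‖^(η-10)` (as `M^J ≥ θ/a_k ≥ ‖z‖`) give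
`c_k² |Cov_k(Q₀,Q_z)| ≤ C(A,κ,M,η) · B · (a_k‖z‖)^(η-10)` on the window. The Wilson measure is a
probability measure (`isProbabilityMeasure_wilsonMeasure`), the densities are bounded. -/
theorem stub_summation :
    ∀ (G : Type) [Group G] [TopologicalSpace G] [IsTopologicalGroup G] [CompactSpace G]
      [MeasurableSpace G] [BorelSpace G], IsCompactSimpleLieGroup G →
      ∀ (r : LatticeRep G) (sch : SpeciesScheme (YMSpecies G)),
        LadderData r sch → LocalLatticeKernelBound r sch := by
  sorry

/-! ## The composition (kernel-checked; `sorry` only inside the five stubs it invokes) -/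

/-- **The line closes the crux** (A12 skeleton shape: concludes `PencilRigidity.CurvatureKernelBound`
BY NAME, no hypotheses; the only gaps are the registered stubs it calls): degenerate branch by
`stub_degenerate`; otherwise the engine's pure ladder data (`stub_ladder`), calibrated by `W₁`
(`stub_calibration`) and summed (`stub_summation`), give the local uniform lattice kernel bound,
which the transfer (`stub_transfer`) turns into the crux's kernel — for every `G, r, sch, S₁` with
`W₁`. The proof term is pure logic (a case split); with the stubs replaced by hypotheses of the
same statements it checks with axioms `propext, Classical.choice, Quot.sound` only. -/
theorem CurvatureKernelBound_of :
    Summit.QuantumFields.YangMills.Theses.PencilRigidity.CurvatureKernelBound := by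
  intro G i1 i2 i3 i4 hG
  letI : MeasurableSpace G := borel G
  haveI : BorelSpace G := ⟨rfl⟩
  intro W₁ r sch S₁ hW
  have hW' : W1 r sch S₁ := hW
  by_cases hB : TruncatedTwoPointVanishes S₁
  · exact stub_degenerate G hG r sch S₁ hW' hB
  · exact stub_transfer G hG r sch S₁ hW'
      (stub_summation G hG r sch
        (stub_calibration G hG r sch S₁ hW' (stub_ladder G hG r sch S₁ hW' hB)))

end Summit.QuantumFields.YangMills.Cruxes.CurvatureKernelBound.BlockFiltrationCovarianceLadder

end
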